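import Literature.NumberTheory.EllipticCurves.PadicLogFiniteExtension
import Literature.NumberTheory.EllipticCurves.LocalPointsIntegersSubgroup
import Literature.NumberTheory.EllipticCurves.GeomPointReduction
import Literature.NumberTheory.EllipticCurves.SupersingularDensityDeuringCriterionProofs
import Literature.NumberTheory.EllipticCurves.FormalGroupChartLimitLogAdicCompletionProofs
import HarnessLib

/-!
# Frobenius annihilation: `(φ² − a_pφ + p)·E(L_w) ⊆ E₁(L_w)`, hence
# `(φ² − a_pφ + p)·log_ω E(L_w) ⊆ p𝒪_w` at an unramified place — the Euler operator on points
# and on the logarithm lattice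

`Proofs` file (theorems only: no definition, no named fact, no instance) in topic
`NumberTheory/EllipticCurves`.  Cell `bsd-addord` (run/shared/lean/pub/bsd-addord/), seat w2-acc3
gen 7, route W2 `KimAtThreeKolyvagin`, support item 20397 `FineKatoTauAnomalousThree` (good-ANOMALOUS
rows): this is PART A of the E-side **lattice lemma**

  `log_ω(E(K) ⊗ ℤ_p) = E_p(φ)⁻¹ · 𝒪_K`,  `E_p(X) = 1 − a_p X/p + X²/p`,

for a finite UNRAMIFIED `K/ℚ_p` with Frobenius `φ` and an elliptic curve `E/ℚ` with good reduction at
`p` (Bloch–Kato 1990, Example 3.11, read through `log = exp⁻¹` on `E(K) ⊗ ℚ_p`; the case `K = ℚ_p`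
is Silverman IV.6.4 / the tree's `PadicLogLatticeIndexProofs`).  Part A is the inclusion
`(φ² − a_pφ + p) · log_ω E(K) ⊆ p𝒪_K = log_ω E₁(K)`, whose content is the classical fact that
**reduction intertwines a lift `φ` of the `p`-power map with the Frobenius endomorphism `F` of
`Ẽ/𝔽_p`, and `F² − a_p F + p = 0` on `Ẽ(𝔽̄_p)`** (Silverman, *AEC*, Thm. V.2.3.1(b) — the tree's
`WeierstrassCurve.frobenius_frobenius_sub_trace_smul_add_card_smul`, Manin's elementary proof — with
Prop. VII.2.1, the reduction homomorphism, the tree's `WeierstrassCurve.reducePoint` /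
`goodReductionHom`).  HONEST FRAMING: tool theorems; nothing here proves BSD or closes an item; the
index half of the lattice lemma (equality up to `#E(K)[p^∞]`) is the sequel.

## Contents

§A1 (any valued field `(L, w)`, curve `X/E`, isometric `σ : L →ₐ[E] L`; namespace
`Literature.NumberTheory.EllipticCurves.FormalGroupChart`):
* `padicLogPointFiniteExt_zsmul` — `log_ω(n • P) = n · log_ω P`, `n ∈ ℤ`;
* `padicLogPointFiniteExt_frobeniusCombination` — **`log_ω(σσP − a·σP + q·P) =
  σ(σ(log_ω P)) − a·σ(log_ω P) + q·log_ω P`** (additivity + Galois equivariance of `log_ω`,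
  `padicLogPointFiniteExt_add/_map` of `PadicLogFiniteExtension`).

§A2–§A4 (`L` a number field, `w` a finite place with `p ∈ w`, `K = L_w = w.adicCompletion L`,
`𝒪_w = w.adicCompletionIntegers L`, `W/ℚ` globally minimal with `p ∤ Δ_min(W)`; namespace
`Literature.NumberTheory.EllipticCurves.EulerLattice`; the valuation is the norm valuation `‖·‖₊`):
* `integers_norm` (`𝒪_w` is the valuation ring of `‖·‖₊`), `valuation_intCast_eq_one_of_not_dvd`
  (`‖n‖_w = 1` for `p ∤ n`), `baseChange_eq_model_baseChange` (`W ⊗ L_w = (W_ℤ ⊗ 𝒪_w) ⊗ L_w`),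
  `isUnit_Δ_model` (good reduction of the model at `w`), `isIntegral_baseChange`;
* `frobeniusCombination_mem_kernel` — **Frobenius annihilation**: for an isometric `ℚ`-algebra
  endomorphism `φ` of `L_w` with `‖φ x − x^p‖ < 1` on `𝒪_w` and every `P ∈ E(L_w)`,
  `φ²P − a_p·φP + p·P ∈ E₁(L_w)` (`FormalGroupChart.kernel`), `a_p = W.frobeniusTrace p`;
* `limitLog_spec_baseChange` ((SPEC) for `limitLog` on `W ⊗ L_w`), `exists_nsmul_mem_kernel` (every
  point has a multiple in `E₁`: `Ẽ(k_w)` is finite);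
* `norm_frobeniusCombination_padicLog_le` — **at an UNRAMIFIED `w` (`‖x‖ < 1 ⇒ ‖x‖ ≤ ‖p‖`):
  `‖φ(φ(log_ω P)) − a_p·φ(log_ω P) + p·log_ω P‖ ≤ ‖p‖` for every `P ∈ E(L_w)`**,
  `log_ω = FormalGroupChart.padicLogPointFiniteExt ‖·‖₊ (W ⊗ L_w) p`.

## Proof of the annihilation

`red : E(L_w) → Ẽ(k_w) → Ẽ(𝔽̄_p)` is assembled from the tree (`goodReductionHom` of the model over
`𝒪_w` along `Affine.Point.congrEquiv`, then `mapPointHom` along an embedding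
`ι : k_w → 𝔽̄_p = AlgebraicClosure (ZMod p)` (`IsAlgClosed.lift`; `k_w` is finite of characteristic
`p`), landing in the `𝔽̄_p`-points of the tree's `reductionModPrime W p`); it is additive with kernel
`E₁(L_w)`, and on an integral point `(x, y)` it is `(ι x̄, ι ȳ)`, so `red(φP) = F(red P)` with
`F = (u, v) ↦ (u^p, v^p)` the action of the arithmetic Frobenius `σ_p ∈ Γ_{𝔽_p}`
(`exists_frobenius_absoluteGaloisGroup`).  The relation `σ_p² − a_pσ_p + p = 0` on
`(reductionModPrime W p).geomPoints` (`frobenius_frobenius_sub_trace_smul_add_card_smul`, with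
`a_p = p + 1 − #Ẽ(𝔽_p)`, `frobeniusTrace_eq_sub_natCard_reductionModPrime`) gives
`red(φ²P − a_pφP + pP) = 0`, i.e. the combination lies in `E₁(L_w)`.  At an unramified place
`E₁ = E⁽ᵖ⁾` (`level_val_natCast_eq_kernel`), on which `‖log_ω‖ ≤ ‖p‖`
(`val_padicLogPointFiniteExt_le_of_mem_level`), and §A1 rewrites `log_ω` of the combination.

## References

* [SilvermanAEC2009] J. H. Silverman, *The Arithmetic of Elliptic Curves*, 2nd ed., GTM 106 (2009):
  Thm. V.2.3.1(b) (`φ² − aφ + q = 0`), Prop. VII.2.1 (reduction homomorphism, kernel `E₁`),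
  Prop. VII.2.2 and Thm. IV.6.4 (the logarithm on `E₁`), Prop. VII.5.1(a) (good reduction).
* [BlochKato1990] S. Bloch, K. Kato, *L-functions and Tamagawa numbers of motives* (1990), §3,
  Example 3.11 (`H¹_f` and `A(K) ⊗ ℤ_p` for an abelian variety with good reduction) — the lattice
  identity this file starts.
* [SerreLocalFields1979] J.-P. Serre, *Local Fields* (1979), Ch. II §1 (valuation ring and residue
  field of a completion).

## Design

`noncomputable section`, `open scoped Classical NNReal`.  No definitions: the reduction map to
`Ẽ(𝔽̄_p)` is a `let` inside the proof.  `L : Type` (universe `0`), because the equivariance layer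
`padicLogPointFiniteExt_map` keeps the base field `E = ℚ` and `L_w` in one universe (number fields
and cyclotomic fields built over `ℚ` live in `Type`).  The Frobenius `φ` is an abstract isometric
`ℚ`-algebra endomorphism with `‖φ x − x^p‖ < 1` on `𝒪_w` (for `L = ℚ(ζ_m)`, `p ∤ m`, take the
completion `galAdicCompletionMap` of `σ_p : ζ ↦ ζ^p` at a place it fixes, through
`RingHom.toRatAlgHom`); unramifiedness enters §A4 only as `‖x‖ < 1 ⇒ ‖x‖ ≤ ‖p‖`.  Integrality of
`W ⊗ L_w` is the theorem `isIntegral_baseChange`, fed by `haveI` in statements (no instance).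
Axioms: `propext`, `Classical.choice`, `Quot.sound`.
-/
noncomputable section

open scoped Classical NNReal

/-! ## §A1 The logarithm of a Frobenius combination (any valued field) -/

namespace Literature.NumberTheory.EllipticCurves.FormalGroupChart

section Abstract

universe u

variable {E : Type u} [Field E] {L : Type u} [Field L] [Algebra E L] {X : WeierstrassCurve E}
  {w : Valuation L ℝ≥0} [hV : (X.baseChange L).IsIntegral w.integer] {p : ℕ}

/-- `log_ω(n • P) = n · log_ω(P)` for an INTEGER `n` (from the `ℕ` case and `log_ω(−P) = −log_ω P`).
[cite: SilvermanAEC2009, Thm. IV.6.4(a) with Prop. VII.2.2] -/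
theorem padicLogPointFiniteExt_zsmul (hp0 : (p : L) ≠ 0) (hp1 : w (p : L) < 1)
    (hℓ : ∀ Q ∈ level w (X.baseChange L) (w (p : L)), ∀ r : ℕ,
      w (limitLog w (X.baseChange L) p Q - ((p ^ r) • Q).zCoord / (p : L) ^ r) ≤ w (p : L) ^ (r + 1))
    {P : (X.baseChange L).toAffine.Point} {m : ℕ} (hm : 0 < m)
    (hmP : m • P ∈ level w (X.baseChange L) (w (p : L))) (n : ℤ) :
    padicLogPointFiniteExt w (X.baseChange L) p (n • P) =
      n * padicLogPointFiniteExt w (X.baseChange L) p P := by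
  obtain ⟨k, rfl | rfl⟩ := Int.eq_nat_or_neg n
  · rw [natCast_zsmul, padicLogPointFiniteExt_nsmul hp0 hp1 hℓ hm hmP, Int.cast_natCast]
  · have hmk : m • (k • P) ∈ level w (X.baseChange L) (w (p : L)) := by
      rw [← mul_nsmul', mul_comm, mul_nsmul']
      exact (level w (X.baseChange L) (w (p : L))).nsmul_mem hmP k
    rw [neg_zsmul, natCast_zsmul, padicLogPointFiniteExt_neg hp0 hp1 hℓ hm hmk,
      padicLogPointFiniteExt_nsmul hp0 hp1 hℓ hm hmP, Int.cast_neg, Int.cast_natCast, neg_mul]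

/-- **The logarithm of the Frobenius combination**: for an isometric `E`-algebra endomorphism `σ`
of `L ⊇ E`, integers `a, q` and a point `P` of `X ⊗ L` (`X/E`) with a multiple in the level,
`log_ω(σσP − a·σP + q·P) = σ(σ(log_ω P)) − a·σ(log_ω P) + q·log_ω P`
(additivity and Galois-equivariance of `log_ω`, `padicLogPointFiniteExt_add/_map`).
[cite: SilvermanAEC2009, Thm. IV.6.4(a) with Prop. VII.2.2] -/
theorem padicLogPointFiniteExt_frobeniusCombination (hp0 : (p : L) ≠ 0) (hp1 : w (p : L) < 1)
    (hℓ : ∀ Q ∈ level w (X.baseChange L) (w (p : L)), ∀ r : ℕ,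
      w (limitLog w (X.baseChange L) p Q - ((p ^ r) • Q).zCoord / (p : L) ^ r) ≤ w (p : L) ^ (r + 1))
    {σ : L →ₐ[E] L} (hσ : ∀ x, w (σ x) = w x) (a q : ℤ)
    {P : (X.baseChange L).toAffine.Point} {m : ℕ} (hm : 0 < m)
    (hmP : m • P ∈ level w (X.baseChange L) (w (p : L))) :
    padicLogPointFiniteExt w (X.baseChange L) p
        (WeierstrassCurve.Affine.Point.map σ (WeierstrassCurve.Affine.Point.map σ P)
          - a • WeierstrassCurve.Affine.Point.map σ P + q • P) =
      σ (σ (padicLogPointFiniteExt w (X.baseChange L) p P))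
        - a * σ (padicLogPointFiniteExt w (X.baseChange L) p P)
        + q * padicLogPointFiniteExt w (X.baseChange L) p P := by
  -- every term has `m` as an admissible multiplier
  have hσP : m • WeierstrassCurve.Affine.Point.map σ P ∈ level w (X.baseChange L) (w (p : L)) := by
    rw [← map_nsmul]; exact map_mem_level_of_isometry hσ hmP
  have hσσP : m • WeierstrassCurve.Affine.Point.map σ (WeierstrassCurve.Affine.Point.map σ P) ∈
      level w (X.baseChange L) (w (p : L)) := by
    rw [← map_nsmul]; exact map_mem_level_of_isometry hσ hσP
  have haP : m • (a • WeierstrassCurve.Affine.Point.map σ P) ∈ level w (X.baseChange L) (w (p : L)) := by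
    rw [smul_comm]; exact (level w (X.baseChange L) (w (p : L))).zsmul_mem hσP a
  have haP' : m • ((-a) • WeierstrassCurve.Affine.Point.map σ P) ∈
      level w (X.baseChange L) (w (p : L)) := by
    rw [smul_comm]; exact (level w (X.baseChange L) (w (p : L))).zsmul_mem hσP (-a)
  have hqP : m • (q • P) ∈ level w (X.baseChange L) (w (p : L)) := by
    rw [smul_comm]; exact (level w (X.baseChange L) (w (p : L))).zsmul_mem hmP q
  have hsub : m • (WeierstrassCurve.Affine.Point.map σ (WeierstrassCurve.Affine.Point.map σ P)
      - a • WeierstrassCurve.Affine.Point.map σ P) ∈ level w (X.baseChange L) (w (p : L)) := by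
    rw [nsmul_sub]; exact (level w (X.baseChange L) (w (p : L))).sub_mem hσσP haP
  have e : WeierstrassCurve.Affine.Point.map σ (WeierstrassCurve.Affine.Point.map σ P)
      - a • WeierstrassCurve.Affine.Point.map σ P =
      WeierstrassCurve.Affine.Point.map σ (WeierstrassCurve.Affine.Point.map σ P)
      + (-a) • WeierstrassCurve.Affine.Point.map σ P := by rw [neg_smul, sub_eq_add_neg]
  rw [padicLogPointFiniteExt_add hp0 hp1 hℓ hm hsub hm hqP, e,
    padicLogPointFiniteExt_add hp0 hp1 hℓ hm hσσP hm haP',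
    padicLogPointFiniteExt_zsmul hp0 hp1 hℓ hm hσP, padicLogPointFiniteExt_zsmul hp0 hp1 hℓ hm hmP,
    padicLogPointFiniteExt_map hp0 hp1 hℓ hσ hm hσP, padicLogPointFiniteExt_map hp0 hp1 hℓ hσ hm hmP]
  push_cast
  ring

end Abstract

end Literature.NumberTheory.EllipticCurves.FormalGroupChart

/-! ## §A2 The completion `K = L_w` at a place over `p`: norm-valuation integers, the model -/

namespace Literature.NumberTheory.EllipticCurves.EulerLattice

open NumberField IsDedekindDomain _root_.WeierstrassCurve Literature.NumberTheory.EllipticCurves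
  Literature.NumberTheory.EllipticCurves.FormalGroupChart

-- `L : Type` (universe `0`): the equivariance layer `padicLogPointFiniteExt_map` keeps the base field `E = ℚ`
-- and `L_w` in ONE universe; cyclotomic / number fields built over `ℚ` live in `Type`.
variable {L : Type} [Field L] [NumberField L] (w : HeightOneSpectrum (𝓞 L))

/-- The norm valuation of `L_w` has valuation ring `𝒪_w` (`‖x‖ ≤ 1 ↔ x ∈ 𝒪_w`).
[cite: SerreLocalFields1979, Ch. II §1] -/
theorem integers_norm :
    (NormedField.valuation : Valuation (w.adicCompletion L) ℝ≥0).Integers (w.adicCompletionIntegers L) where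
  hom_inj := Subtype.val_injective
  map_le_one := fun a => LocalPoints.valuation_coe_le_one w a
  exists_of_le_one := fun r hr => ⟨⟨r, (LocalPoints.norm_le_one_iff_mem w r).mp (by
    have h := hr; rwa [LocalPoints.valuation_apply, ← NNReal.coe_le_coe, coe_nnnorm, NNReal.coe_one] at h)⟩, rfl⟩

/-- For a place `w` over `p`, an integer `n` prime to `p` is a unit at `w`: `‖n‖_w = 1` (`w ∩ ℤ = pℤ`).
[cite: SerreLocalFields1979, Ch. II §1] -/
theorem valuation_intCast_eq_one_of_not_dvd {p : ℕ} [hp : Fact p.Prime] (hw : ((p : ℕ) : 𝓞 L) ∈ w.asIdeal)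
    {n : ℤ} (hn : ¬ (p : ℤ) ∣ n) :
    (NormedField.valuation : Valuation (w.adicCompletion L) ℝ≥0) (n : w.adicCompletion L) = 1 := by
  -- `|n| : ℕ` is not in `w`: otherwise `1 = a |n| + b p ∈ w`
  have hmem : ((n.natAbs : ℕ) : 𝓞 L) ∉ w.asIdeal := by
    intro hmem
    have hcop : Nat.Coprime p n.natAbs := by
      rw [Nat.Prime.coprime_iff_not_dvd hp.out]
      exact fun h => hn (Int.natCast_dvd.mpr (by simpa using h))
    obtain ⟨a, b, hab⟩ := (Nat.Coprime.isCoprime hcop)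
    have h1 : (1 : 𝓞 L) ∈ w.asIdeal := by
      have e : (a : 𝓞 L) * ((p : ℕ) : 𝓞 L) + (b : 𝓞 L) * ((n.natAbs : ℕ) : 𝓞 L) = 1 := by
        have := congrArg (Int.cast : ℤ → 𝓞 L) hab
        simpa only [Int.cast_add, Int.cast_mul, Int.cast_natCast, Int.cast_one] using this
      rw [← e]
      exact w.asIdeal.add_mem (w.asIdeal.mul_mem_left _ hw) (w.asIdeal.mul_mem_left _ hmem)
    exact w.isPrime.ne_top ((Ideal.eq_top_iff_one _).mpr h1)
  have h := LocalPoints.valuation_natCast_eq_one w hmem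
  rcases Int.natAbs_eq n with hn' | hn'
  · rw [hn', Int.cast_natCast]; exact h
  · rw [hn', Int.cast_neg, Int.cast_natCast, Valuation.map_neg]; exact h

variable (W : WeierstrassCurve ℚ) [W.IsGloballyMinimal]

/-- The canonical curve `W ⊗ L_w` of a globally minimal `W/ℚ` is the base change of the integral
model `W_ℤ ⊗ 𝒪_w` over the valuation ring. [cite: SilvermanAEC2009, VII.1 and VIII.8 (global minimal models)] -/
theorem baseChange_eq_model_baseChange :
    W.baseChange (w.adicCompletion L) =
      ((integralModelInt W).map (Int.castRingHom (w.adicCompletionIntegers L))).baseChange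
        (w.adicCompletion L) := by
  conv_lhs => rw [← map_integralModelInt W]
  rw [baseChange, baseChange, map_map, map_map]
  exact congrArg (integralModelInt W).map (RingHom.ext_int _ _)

/-- Good reduction at `w ∣ p` for `p ∤ Δ_min(W)`: the discriminant of `W_ℤ ⊗ 𝒪_w` is a unit.
[cite: SilvermanAEC2009, Prop. VII.5.1(a)] -/
theorem isUnit_Δ_model {p : ℕ} [Fact p.Prime] (hw : ((p : ℕ) : 𝓞 L) ∈ w.asIdeal)
    (hΔ : ¬ (p : ℤ) ∣ minimalDiscriminantInt W) :
    IsUnit ((integralModelInt W).map (Int.castRingHom (w.adicCompletionIntegers L))).Δ := by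
  rw [map_Δ, LocalPoints.isUnit_iff_valuation_eq_one, eq_intCast]
  exact valuation_intCast_eq_one_of_not_dvd w hw hΔ

/-- `W ⊗ L_w` is integral for the norm valuation. [cite: SilvermanAEC2009, VII.1 (integral models)] -/
theorem isIntegral_baseChange :
    (W.baseChange (w.adicCompletion L)).IsIntegral
      ((NormedField.valuation : Valuation (w.adicCompletion L) ℝ≥0)).integer := by
  rw [baseChange_eq_model_baseChange w W]
  exact LocalPoints.isIntegral_baseChange w
    ((integralModelInt W).map (Int.castRingHom (w.adicCompletionIntegers L)))


/-! ## §A3 Frobenius annihilation: `(φ² − a_pφ + p)·E(L_w) ⊆ E₁(L_w)` -/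

section Annihilation

variable {p : ℕ} [hp : Fact p.Prime]

/-- **Frobenius annihilation.**  Let `W/ℚ` be globally minimal with good reduction at `p`
(`p ∤ Δ_min`), `w ∣ p` a place of the number field `L`, `K = L_w`, and `φ` an ISOMETRIC
`ℚ`-algebra endomorphism of `K` lifting the `p`-power map of the residue field
(`‖φ x − x^p‖ < 1` on `𝒪_w`; e.g. the Frobenius of an unramified `K/ℚ_p`).  Then for every
`P ∈ E(K)` the point `φ²P − a_p·φP + p·P` lies in the kernel of reduction `E₁(K)`
(`a_p = W.frobeniusTrace p = p + 1 − #Ẽ(𝔽_p)`): reduction `E(K) → Ẽ(k_w) ⊆ Ẽ(𝔽̄_p)` is a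
homomorphism intertwining `φ` with the `p`-power Frobenius `F` of `Ẽ/𝔽_p`, and
`F² − a_p F + p = 0` on `Ẽ(𝔽̄_p)` (Silverman V.2.3.1(b), the tree's
`frobenius_frobenius_sub_trace_smul_add_card_smul`).
[cite: SilvermanAEC2009, Thm. V.2.3.1(b) with Prop. VII.2.1] -/
theorem frobeniusCombination_mem_kernel (hw : ((p : ℕ) : 𝓞 L) ∈ w.asIdeal)
    (hΔ : ¬ (p : ℤ) ∣ minimalDiscriminantInt W)
    (φ : w.adicCompletion L →ₐ[ℚ] w.adicCompletion L) (hφ : ∀ x, ‖φ x‖ = ‖x‖)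
    (hφp : ∀ x : w.adicCompletion L, ‖x‖ ≤ 1 → ‖φ x - x ^ p‖ < 1)
    (P : (W.baseChange (w.adicCompletion L)).toAffine.Point) :
    haveI := isIntegral_baseChange w W
    Affine.Point.map φ (Affine.Point.map φ P) - (W.frobeniusTrace p) • Affine.Point.map φ P
        + (p : ℤ) • P ∈
      kernel (NormedField.valuation : Valuation (w.adicCompletion L) ℝ≥0)
        (W.baseChange (w.adicCompletion L)) := by
  classical
  haveI hint := isIntegral_baseChange w W
  have hv := integers_norm w
  -- the model over `𝒪_w` and its reduction
  set W₀ : WeierstrassCurve (w.adicCompletionIntegers L) :=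
    (integralModelInt W).map (Int.castRingHom (w.adicCompletionIntegers L)) with hW₀
  have hX : W.baseChange (w.adicCompletion L) = W₀.baseChange (w.adicCompletion L) :=
    baseChange_eq_model_baseChange w W
  have hΔ₀ : IsUnit W₀.Δ := isUnit_Δ_model w W hw hΔ
  -- the residue field has characteristic `p`; embed it into `𝔽̄_p`
  have hpk : ((p : ℕ) : IsLocalRing.ResidueField (w.adicCompletionIntegers L)) = 0 := by
    have h := (HeightOneSpectrum.residue_algebraMap_eq_zero_iff L w ((p : ℕ) : 𝓞 L)).mpr hw
    rwa [map_natCast, map_natCast] at h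
  haveI hchar : CharP (IsLocalRing.ResidueField (w.adicCompletionIntegers L)) p :=
    (CharP.charP_iff_prime_eq_zero hp.out).mpr hpk
  letI : Algebra (ZMod p) (IsLocalRing.ResidueField (w.adicCompletionIntegers L)) :=
    ZMod.algebra _ p
  haveI : Algebra.IsAlgebraic (ZMod p) (IsLocalRing.ResidueField (w.adicCompletionIntegers L)) :=
    Algebra.IsAlgebraic.of_finite (ZMod p) _
  let ι : IsLocalRing.ResidueField (w.adicCompletionIntegers L) →ₐ[ZMod p] AlgebraicClosure (ZMod p) :=
    IsAlgClosed.lift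
  have hē : (W₀.map (IsLocalRing.residue (w.adicCompletionIntegers L))).map
      (ι : IsLocalRing.ResidueField (w.adicCompletionIntegers L) →+* AlgebraicClosure (ZMod p)) =
      (reductionModPrime W p).baseChange (AlgebraicClosure (ZMod p)) := by
    rw [hW₀, reductionModPrime, baseChange, map_map, map_map, map_map]
    exact congrArg (integralModelInt W).map (RingHom.ext_int _ _)
  haveI : (reductionModPrime W p).IsElliptic := isElliptic_reductionModPrime W hΔ
  obtain ⟨σ, hσ⟩ := exists_frobenius_absoluteGaloisGroup (ZMod p)
  have hcard : Nat.card (ZMod p) = p := Nat.card_zmod p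
  -- the `p`-power Frobenius on `𝔽̄_p`-points, and its relation to the Galois action on `Ẽ(𝔽̄_p)`
  let Fr : ((reductionModPrime W p).baseChange (AlgebraicClosure (ZMod p))).toAffine.Point →+
      ((reductionModPrime W p).baseChange (AlgebraicClosure (ZMod p))).toAffine.Point :=
    Affine.Point.map ((Field.absoluteGaloisGroup.toAlgEquiv (ZMod p) σ :
      AlgebraicClosure (ZMod p) ≃ₐ[ZMod p] AlgebraicClosure (ZMod p)) :
        AlgebraicClosure (ZMod p) →ₐ[ZMod p] AlgebraicClosure (ZMod p))
  let ιd : (reductionModPrime W p).geomPoints →+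
      ((reductionModPrime W p).baseChange (AlgebraicClosure (ZMod p))).toAffine.Point := AddMonoidHom.id _
  have hιd : ∀ R : (reductionModPrime W p).geomPoints, ιd (σ • R) = Fr (ιd R) := fun _ => rfl
  have hrelF : ∀ R : ((reductionModPrime W p).baseChange (AlgebraicClosure (ZMod p))).toAffine.Point,
      Fr (Fr R) - (W.frobeniusTrace p) • Fr R + (p : ℤ) • R = 0 := by
    intro R
    have h := congrArg ιd ((reductionModPrime W p).frobenius_frobenius_sub_trace_smul_add_card_smul hσ
      (show (reductionModPrime W p).geomPoints from R))
    rw [map_add, map_sub, map_zsmul, map_zsmul, hιd, hιd, map_zero, hcard,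
      ← frobeniusTrace_eq_sub_natCard_reductionModPrime] at h
    exact h
  have hFr_some : ∀ (u v : AlgebraicClosure (ZMod p))
      (huv : ((reductionModPrime W p).baseChange (AlgebraicClosure (ZMod p))).toAffine.Nonsingular u v),
      ∃ huv', Fr (Affine.Point.some u v huv) = Affine.Point.some (u ^ p) (v ^ p) huv' := by
    intro u v huv
    obtain ⟨h', e⟩ : ∃ h', Fr (Affine.Point.some u v huv) = Affine.Point.some
        ((Field.absoluteGaloisGroup.toAlgEquiv (ZMod p) σ) u)
        ((Field.absoluteGaloisGroup.toAlgEquiv (ZMod p) σ) v) h' := ⟨_, rfl⟩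
    rw [e]
    refine ⟨?_, point_some_congr ?_ ?_⟩
    · have hu : (Field.absoluteGaloisGroup.toAlgEquiv (ZMod p) σ) u = u ^ p := by
        show σ • u = u ^ p; rw [hσ, hcard]
      have hv' : (Field.absoluteGaloisGroup.toAlgEquiv (ZMod p) σ) v = v ^ p := by
        show σ • v = v ^ p; rw [hσ, hcard]
      rw [← hu, ← hv']; exact h'
    · show σ • u = u ^ p; rw [hσ, hcard]
    · show σ • v = v ^ p; rw [hσ, hcard]
  -- the reduction map to `𝔽̄_p`-points of `Ẽ/𝔽_p`
  let red : (W.baseChange (w.adicCompletion L)).toAffine.Point →+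
      ((reductionModPrime W p).baseChange (AlgebraicClosure (ZMod p))).toAffine.Point :=
    (Affine.Point.congrEquiv hē).toAddMonoidHom.comp <|
      ((W₀.map (IsLocalRing.residue (w.adicCompletionIntegers L))).mapPointHom
          (ι : IsLocalRing.ResidueField (w.adicCompletionIntegers L) →+* AlgebraicClosure (ZMod p))).comp <|
        (goodReductionHom W₀ hv hΔ₀).comp (Affine.Point.congrEquiv hX).toAddMonoidHom
  have hred_apply : ∀ Q, red Q = Affine.Point.congrEquiv hē
      ((W₀.map (IsLocalRing.residue (w.adicCompletionIntegers L))).mapPointHom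
        (ι : IsLocalRing.ResidueField (w.adicCompletionIntegers L) →+* AlgebraicClosure (ZMod p))
        (WeierstrassCurve.reducePoint W₀ (Affine.Point.congrEquiv hX Q))) := fun _ => rfl
  -- residues: `φ` reduces to the `p`-power map
  have hres : ∀ (x₀ : w.adicCompletionIntegers L) (hφx : ‖φ (x₀ : w.adicCompletion L)‖ ≤ 1),
      IsLocalRing.residue (w.adicCompletionIntegers L) ⟨φ x₀, (LocalPoints.norm_le_one_iff_mem w _).mp hφx⟩ =
        IsLocalRing.residue (w.adicCompletionIntegers L) x₀ ^ p := by
    intro x₀ hφx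
    rw [← map_pow, ← sub_eq_zero, ← map_sub, IsLocalRing.residue_eq_zero_iff,
      LocalPoints.mem_maximalIdeal_iff, LocalPoints.valuation_apply, ← NNReal.coe_lt_coe, coe_nnnorm,
      NNReal.coe_one]
    exact hφp x₀ ((LocalPoints.norm_le_one_iff_mem w _).mpr x₀.2)
  -- `red` on an integral point is coordinatewise
  have key : ∀ (a b : w.adicCompletionIntegers L)
      (hab : (W.baseChange (w.adicCompletion L)).toAffine.Nonsingular (a : w.adicCompletion L) b),
      ∃ hns, red (Affine.Point.some _ _ hab) =
        Affine.Point.some (ι (IsLocalRing.residue _ a)) (ι (IsLocalRing.residue _ b)) hns := by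
    intro a b hab
    have hab' : (W₀.baseChange (w.adicCompletion L)).toAffine.Nonsingular
        (algebraMap (w.adicCompletionIntegers L) (w.adicCompletion L) a)
        (algebraMap (w.adicCompletionIntegers L) (w.adicCompletion L) b) := hX ▸ hab
    have hns : (W₀.map (IsLocalRing.residue (w.adicCompletionIntegers L))).toAffine.Nonsingular
        (IsLocalRing.residue _ a) (IsLocalRing.residue _ b) :=
      (WeierstrassCurve.hasNonsingularReduction_some_algebraMap_iff hv.hom_inj hab').mp
        (hasNonsingularReduction_of_isUnit_Δ hv hΔ₀ _)
    have e2 : WeierstrassCurve.reducePoint W₀ (Affine.Point.congrEquiv hX (Affine.Point.some _ _ hab)) =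
        Affine.Point.some _ _ hns := by
      rw [Affine.Point.congrEquiv_some]
      exact WeierstrassCurve.reducePoint_some_algebraMap hv.hom_inj hab' hns
    rw [hred_apply, e2, mapPointHom_some, Affine.Point.congrEquiv_some]
    exact ⟨_, rfl⟩
  -- `red` vanishes on `E₁`
  have h0 : ∀ (x' y' : w.adicCompletion L)
      (h' : (W.baseChange (w.adicCompletion L)).toAffine.Nonsingular x' y'),
      1 < ‖x'‖ → red (Affine.Point.some x' y' h') = 0 := by
    intro x' y' h' hx'
    rw [hred_apply, Affine.Point.congrEquiv_some]
    have hz : WeierstrassCurve.reducePoint W₀ (Affine.Point.some x' y' (hX ▸ h')) = 0 := by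
      refine WeierstrassCurve.ReducesToZero.reducePoint_eq_zero ?_
      rw [WeierstrassCurve.reducesToZero_some_iff, not_mem_range_iff hv, LocalPoints.valuation_apply,
        ← NNReal.coe_lt_coe, coe_nnnorm, NNReal.coe_one]
      exact hx'
    rw [hz, map_zero, map_zero]
  -- KEY: reduction intertwines `φ` with the Frobenius
  have hred_frob : ∀ Q, red (Affine.Point.map φ Q) = Fr (red Q) := by
    intro Q
    rcases Q with _ | ⟨x, y, h⟩
    · rw [← Affine.Point.zero_def, map_zero, map_zero, map_zero]
    obtain ⟨hφns, hmap⟩ : ∃ hφns, Affine.Point.map φ (Affine.Point.some x y h) =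
        Affine.Point.some (φ x) (φ y) hφns := ⟨_, rfl⟩
    rw [hmap]
    by_cases hx : ‖x‖ ≤ 1
    · -- integral point: reduction is coordinatewise
      have hh : (W₀.baseChange (w.adicCompletion L)).toAffine.Nonsingular x y := hX ▸ h
      have hy : ‖y‖ ≤ 1 := by
        have h' := v_Y_le_one_of_v_X_le_one hv hh.1 (by
          rw [LocalPoints.valuation_apply, ← NNReal.coe_le_coe, coe_nnnorm, NNReal.coe_one]; exact hx)
        rwa [LocalPoints.valuation_apply, ← NNReal.coe_le_coe, coe_nnnorm, NNReal.coe_one] at h'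
      have hφx : ‖φ x‖ ≤ 1 := by rw [hφ]; exact hx
      have hφy : ‖φ y‖ ≤ 1 := by rw [hφ]; exact hy
      let x₀ : w.adicCompletionIntegers L := ⟨x, (LocalPoints.norm_le_one_iff_mem w _).mp hx⟩
      let y₀ : w.adicCompletionIntegers L := ⟨y, (LocalPoints.norm_le_one_iff_mem w _).mp hy⟩
      let x₁ : w.adicCompletionIntegers L := ⟨φ x, (LocalPoints.norm_le_one_iff_mem w _).mp hφx⟩
      let y₁ : w.adicCompletionIntegers L := ⟨φ y, (LocalPoints.norm_le_one_iff_mem w _).mp hφy⟩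
      obtain ⟨hns₀, e₀⟩ := key x₀ y₀ h
      obtain ⟨hns₁, e₁⟩ := key x₁ y₁ hφns
      obtain ⟨hns', eF⟩ := hFr_some _ _ hns₀
      rw [e₁, e₀, eF]
      refine point_some_congr ?_ ?_
      · rw [← map_pow, ← hres x₀ hφx]
      · rw [← map_pow, ← hres y₀ hφy]
    · -- `P ∈ E₁`: both sides vanish
      rw [not_le] at hx
      rw [h0 _ _ _ (by rw [hφ]; exact hx), h0 _ _ _ hx, map_zero]
  -- the Frobenius relation kills `red P`
  have hQ : red (Affine.Point.map φ (Affine.Point.map φ P) - (W.frobeniusTrace p) • Affine.Point.map φ P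
      + (p : ℤ) • P) = 0 := by
    rw [map_add, map_sub, map_zsmul, map_zsmul, hred_frob, hred_frob]
    exact hrelF (red P)
  -- unwind: `red Q = 0 ⇒ Q ∈ E₁`
  generalize hQdef : Affine.Point.map φ (Affine.Point.map φ P) - (W.frobeniusTrace p) • Affine.Point.map φ P
      + (p : ℤ) • P = Q at hQ ⊢
  have hQ' : goodReductionHom W₀ hv hΔ₀ (Affine.Point.congrEquiv hX Q) = 0 := by
    rw [hred_apply] at hQ
    have h1 := (Affine.Point.congrEquiv hē).injective (hQ.trans (map_zero _).symm)
    exact mapPointHom_injective _ _ (h1.trans (map_zero _).symm)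
  rw [goodReductionHom_eq_zero_iff] at hQ'
  rcases Q with _ | ⟨x, y, h⟩
  · exact AddSubgroup.zero_mem _
  · rw [Affine.Point.congrEquiv_some, WeierstrassCurve.reducesToZero_some_iff, not_mem_range_iff hv] at hQ'
    show (Affine.Point.some x y h : (W.baseChange (w.adicCompletion L)).toAffine.Point) ∈
      kernel (NormedField.valuation : Valuation (w.adicCompletion L) ℝ≥0) (W.baseChange (w.adicCompletion L))
    exact (some_mem_kernel_iff (w := (NormedField.valuation : Valuation (w.adicCompletion L) ℝ≥0)) h).mpr hQ'

end Annihilation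

/-! ## §A4 The logarithm: `(φ² − a_pφ + p)·log_ω E(L_w) ⊆ p𝒪_w` for unramified `w` -/

section Log

variable {p : ℕ} [hp : Fact p.Prime]

/-- (SPEC) for the limit logarithm `limitLog` on the level `E⁽ᵖ⁾(L_w)` of `W ⊗ L_w` (completeness of
`L_w`, `LocalPoints.exists_limit_of_geometric`, fed to `limitLog_spec`).
[cite: SilvermanAEC2009, Thm. IV.6.4 with Prop. VII.2.2] -/
theorem limitLog_spec_baseChange (hw : ((p : ℕ) : 𝓞 L) ∈ w.asIdeal) :
    haveI := isIntegral_baseChange w W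
    ∀ Q ∈ level (NormedField.valuation : Valuation (w.adicCompletion L) ℝ≥0)
        (W.baseChange (w.adicCompletion L))
        ((NormedField.valuation : Valuation (w.adicCompletion L) ℝ≥0) (p : w.adicCompletion L)), ∀ r : ℕ,
      (NormedField.valuation : Valuation (w.adicCompletion L) ℝ≥0)
          (limitLog (NormedField.valuation : Valuation (w.adicCompletion L) ℝ≥0)
              (W.baseChange (w.adicCompletion L)) p Q - ((p ^ r) • Q).zCoord / (p : w.adicCompletion L) ^ r) ≤
        (NormedField.valuation : Valuation (w.adicCompletion L) ℝ≥0) (p : w.adicCompletion L) ^ (r + 1) := by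
  haveI := isIntegral_baseChange w W
  have hp1 : (NormedField.valuation : Valuation (w.adicCompletion L) ℝ≥0) (p : w.adicCompletion L) < 1 :=
    LocalPoints.valuation_natCast_lt_one w hw
  have hp0 : (p : w.adicCompletion L) ≠ 0 := by
    rw [← map_natCast (algebraMap L (w.adicCompletion L)) p]
    exact (map_ne_zero _).mpr (Nat.cast_ne_zero.mpr hp.out.ne_zero)
  refine limitLog_spec hp0 fun x hx ↦ ?_
  obtain ⟨y, hy⟩ := LocalPoints.exists_limit_of_geometric w x
    ((NormedField.valuation : Valuation (w.adicCompletion L) ℝ≥0) (p : w.adicCompletion L))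
    ((NormedField.valuation : Valuation (w.adicCompletion L) ℝ≥0) (p : w.adicCompletion L)) hp1
    (fun k ↦ by rw [← pow_succ']; exact hx k)
  exact ⟨y, fun r ↦ by rw [pow_succ']; exact hy r⟩

/-- Under good reduction at `w ∣ p` every point of `E(L_w)` has a positive multiple in the kernel of
reduction `E₁(L_w)` (the reduction homomorphism onto the FINITE group `Ẽ(k_w)` has kernel `E₁`).
[cite: SilvermanAEC2009, Prop. VII.2.1] -/
theorem exists_nsmul_mem_kernel (hw : ((p : ℕ) : 𝓞 L) ∈ w.asIdeal)
    (hΔ : ¬ (p : ℤ) ∣ minimalDiscriminantInt W) (P : (W.baseChange (w.adicCompletion L)).toAffine.Point) :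
    haveI := isIntegral_baseChange w W
    ∃ m : ℕ, 0 < m ∧ m • P ∈ kernel (NormedField.valuation : Valuation (w.adicCompletion L) ℝ≥0)
      (W.baseChange (w.adicCompletion L)) := by
  classical
  haveI hint := isIntegral_baseChange w W
  have hv := integers_norm w
  set W₀ : WeierstrassCurve (w.adicCompletionIntegers L) :=
    (integralModelInt W).map (Int.castRingHom (w.adicCompletionIntegers L)) with hW₀
  have hX : W.baseChange (w.adicCompletion L) = W₀.baseChange (w.adicCompletion L) :=
    baseChange_eq_model_baseChange w W
  have hΔ₀ : IsUnit W₀.Δ := isUnit_Δ_model w W hw hΔ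
  haveI : Finite (W₀.map (IsLocalRing.residue (w.adicCompletionIntegers L))).toAffine.Point :=
    WeierstrassCurve.finite_point _
  let red := (goodReductionHom W₀ hv hΔ₀).comp (Affine.Point.congrEquiv hX).toAddMonoidHom
  have hfin : IsOfFinAddOrder (red P) := isOfFinAddOrder_of_finite _
  refine ⟨addOrderOf (red P), hfin.addOrderOf_pos, ?_⟩
  have hker : goodReductionHom W₀ hv hΔ₀ (Affine.Point.congrEquiv hX (addOrderOf (red P) • P)) = 0 := by
    have h := addOrderOf_nsmul_eq_zero (red P)
    rwa [← map_nsmul] at h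
  rw [goodReductionHom_eq_zero_iff] at hker
  generalize hQ : addOrderOf (red P) • P = Q at hker ⊢
  rcases Q with _ | ⟨x, y, h⟩
  · exact AddSubgroup.zero_mem _
  · rw [Affine.Point.congrEquiv_some, WeierstrassCurve.reducesToZero_some_iff, not_mem_range_iff hv] at hker
    show (Affine.Point.some x y h : (W.baseChange (w.adicCompletion L)).toAffine.Point) ∈
      kernel (NormedField.valuation : Valuation (w.adicCompletion L) ℝ≥0) (W.baseChange (w.adicCompletion L))
    exact (some_mem_kernel_iff (w := (NormedField.valuation : Valuation (w.adicCompletion L) ℝ≥0)) h).mpr hker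

/-- **`(φ² − a_pφ + p)·log_ω E(L_w) ⊆ p𝒪_w` at an UNRAMIFIED place `w ∣ p`** (`‖x‖ < 1 ⇒ ‖x‖ ≤ ‖p‖`
on `L_w`).  For `W/ℚ` globally minimal with good reduction at `p`, `φ` an isometric `ℚ`-algebra
endomorphism of `L_w` lifting `x ↦ x^p`, and every `P ∈ E(L_w)`:
`‖φ(φ(log_ω P)) − a_p·φ(log_ω P) + p·log_ω P‖ ≤ ‖p‖`, where `log_ω = padicLogPointFiniteExt` is the
logarithm of `W ⊗ L_w` for the norm valuation — i.e. the Euler operator `p·E_p(φ)` maps the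
logarithm lattice `log_ω E(L_w)` into `p𝒪_w = log_ω E₁(L_w)`.  (Frobenius annihilation
`frobeniusCombination_mem_kernel` + `E₁ = E⁽ᵖ⁾` at an unramified place + `log_ω E⁽ᵖ⁾ ⊆ p𝒪` +
additivity/equivariance of `log_ω`.)  This is the inclusion `log_ω E(K) ⊆ (p·E_p(φ))⁻¹ p𝒪_K` of the
lattice identity `log_ω(E(K) ⊗ ℤ_p) = E_p(φ)⁻¹·𝒪_K`… for unramified `K` (Bloch–Kato, Ex. 3.11).
[cite: SilvermanAEC2009, Thm. V.2.3.1(b), Prop. VII.2.1 and Thm. IV.6.4(b)] [cite: BlochKato1990, Example 3.11] -/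
theorem norm_frobeniusCombination_padicLog_le (hw : ((p : ℕ) : 𝓞 L) ∈ w.asIdeal)
    (hΔ : ¬ (p : ℤ) ∣ minimalDiscriminantInt W)
    (hdisc : ∀ x : w.adicCompletion L, ‖x‖ < 1 → ‖x‖ ≤ ‖(p : w.adicCompletion L)‖)
    (φ : w.adicCompletion L →ₐ[ℚ] w.adicCompletion L) (hφ : ∀ x, ‖φ x‖ = ‖x‖)
    (hφp : ∀ x : w.adicCompletion L, ‖x‖ ≤ 1 → ‖φ x - x ^ p‖ < 1)
    (P : (W.baseChange (w.adicCompletion L)).toAffine.Point) :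
    haveI := isIntegral_baseChange w W
    ‖φ (φ (padicLogPointFiniteExt (NormedField.valuation : Valuation (w.adicCompletion L) ℝ≥0)
            (W.baseChange (w.adicCompletion L)) p P))
        - (W.frobeniusTrace p : w.adicCompletion L) *
          φ (padicLogPointFiniteExt (NormedField.valuation : Valuation (w.adicCompletion L) ℝ≥0)
            (W.baseChange (w.adicCompletion L)) p P)
        + (p : w.adicCompletion L) *
          padicLogPointFiniteExt (NormedField.valuation : Valuation (w.adicCompletion L) ℝ≥0)
            (W.baseChange (w.adicCompletion L)) p P‖ ≤ ‖(p : w.adicCompletion L)‖ := by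
  haveI hint := isIntegral_baseChange w W
  have hp1 : (NormedField.valuation : Valuation (w.adicCompletion L) ℝ≥0) (p : w.adicCompletion L) < 1 :=
    LocalPoints.valuation_natCast_lt_one w hw
  have hp0 : (p : w.adicCompletion L) ≠ 0 := by
    rw [← map_natCast (algebraMap L (w.adicCompletion L)) p]
    exact (map_ne_zero _).mpr (Nat.cast_ne_zero.mpr hp.out.ne_zero)
  have hℓ := limitLog_spec_baseChange w W hw
  have hdisc' : ∀ x : w.adicCompletion L,
      (NormedField.valuation : Valuation (w.adicCompletion L) ℝ≥0) x < 1 →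
        (NormedField.valuation : Valuation (w.adicCompletion L) ℝ≥0) x ≤
          (NormedField.valuation : Valuation (w.adicCompletion L) ℝ≥0) (p : w.adicCompletion L) := by
    intro x hx
    rw [LocalPoints.valuation_apply, ← NNReal.coe_lt_coe, coe_nnnorm, NNReal.coe_one] at hx
    rw [LocalPoints.valuation_apply, LocalPoints.valuation_apply, ← NNReal.coe_le_coe, coe_nnnorm, coe_nnnorm]
    exact hdisc x hx
  have hlevel := level_val_natCast_eq_kernel (V := W.baseChange (w.adicCompletion L)) (p := p) hdisc'
  have hφv : ∀ x, (NormedField.valuation : Valuation (w.adicCompletion L) ℝ≥0) (φ x) =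
      (NormedField.valuation : Valuation (w.adicCompletion L) ℝ≥0) x := by
    intro x
    rw [LocalPoints.valuation_apply, LocalPoints.valuation_apply]
    ext
    rw [coe_nnnorm, coe_nnnorm, hφ]
  -- `P` has a multiple in the level
  obtain ⟨m, hm, hmP⟩ := exists_nsmul_mem_kernel w W hw hΔ P
  rw [← hlevel] at hmP
  -- the Frobenius combination lies in `E₁ = E⁽ᵖ⁾`
  have hQ : (Affine.Point.map φ (Affine.Point.map φ P) - (W.frobeniusTrace p) • Affine.Point.map φ P
      + (p : ℤ) • P) ∈ kernel (NormedField.valuation : Valuation (w.adicCompletion L) ℝ≥0)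
        (W.baseChange (w.adicCompletion L)) :=
    frobeniusCombination_mem_kernel w W hw hΔ φ hφ hφp P
  rw [← hlevel] at hQ
  have hval := val_padicLogPointFiniteExt_le_of_mem_level hp0 hp1 hℓ hQ
  have e := padicLogPointFiniteExt_frobeniusCombination (X := W) (σ := φ)
    hp0 hp1 hℓ hφv (W.frobeniusTrace p) (p : ℤ) hm hmP
  rw [e, LocalPoints.valuation_apply, LocalPoints.valuation_apply, ← NNReal.coe_le_coe, coe_nnnorm,
    coe_nnnorm, Int.cast_natCast] at hval
  exact hval

end Log

end Literature.NumberTheory.EllipticCurves.EulerLattice
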